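import Literature.MathematicalPhysics.QuantumLattice.ReducedBCSTorus

/-!
# Crux `CwThesis` (item `stmt-HubbardSuperconductivity-10438`): the level sets of the square-lattice band on
# the momentum grid have at most `2L` points

Negative-side support (standing disprover, free-endpoint programme, file 1): for the nearest-neighbour band
`ε_L(k) = -2(cos(2πk₁/L) + cos(2πk₂/L))` on `(ℤ/Lℤ)²` (`torusBand`), every level set
`{k : ε_L(k) = c}` has at most `2L` elements (`card_levelSet_torusBand_le`): in each row `k₁ = const` the
equation `cos(2πk₂/L) = c'` has at most the two solutions `k₂ = ±a` (`Real.cos_eq_cos_iff`). This is the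
"no flat band at the Fermi level" input of the free-endpoint bound (a level set of size `≫ L` at the Fermi
energy would allow pair condensation in the free model). Folklore trigonometry; no definitions.
-/

noncomputable section

namespace Summit.HubbardSuperconductivity.CwThesis.Negative

open Finset Real Literature.MathematicalPhysics.QuantumLattice Literature.Probability.LatticeModels

variable {L : ℕ} [NeZero L]

/-- Two residues with the same cosine of the lattice angle are equal or opposite:
`cos(2πa/L) = cos(2πb/L) → b = a ∨ b = -a` in `ℤ/Lℤ`. [folklore] -/
theorem zmod_eq_or_eq_neg_of_cos_eq {a b : ZMod L}
    (h : Real.cos (2 * π * (a.val : ℝ) / L) = Real.cos (2 * π * (b.val : ℝ) / L)) :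
    b = a ∨ b = -a := by
  have hLpos : (0:ℝ) < L := by exact_mod_cast Nat.pos_of_ne_zero (NeZero.ne L)
  have hq : (2 * π / (L:ℝ)) ≠ 0 := (div_pos (by positivity) hLpos).ne'
  rw [Real.cos_eq_cos_iff] at h
  obtain ⟨m, hm | hm⟩ := h
  · left
    have e1 : 2 * π * (b.val : ℝ) / L = (2 * π / L) * b.val := by ring
    have e2 : 2 * (m : ℝ) * π + 2 * π * (a.val : ℝ) / L = (2 * π / L) * (m * L + a.val) := by
      field_simp
    rw [e1, e2] at hm
    have h1 : (b.val : ℝ) = m * L + a.val := mul_left_cancel₀ hq hm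
    have h2 : ((b.val : ℕ) : ℤ) = m * L + (a.val : ℕ) := by exact_mod_cast h1
    have h3 := congrArg (fun z : ℤ => (z : ZMod L)) h2
    simp only [Int.cast_natCast, ZMod.natCast_zmod_val, Int.cast_add, Int.cast_mul, ZMod.natCast_self,
      mul_zero, zero_add] at h3
    exact h3
  · right
    have e1 : 2 * π * (b.val : ℝ) / L = (2 * π / L) * b.val := by ring
    have e2 : 2 * (m : ℝ) * π - 2 * π * (a.val : ℝ) / L = (2 * π / L) * (m * L - a.val) := by
      field_simp
    rw [e1, e2] at hm
    have h1 : (b.val : ℝ) = m * L - a.val := mul_left_cancel₀ hq hm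
    have h2 : ((b.val : ℕ) : ℤ) = m * L - (a.val : ℕ) := by exact_mod_cast h1
    have h3 := congrArg (fun z : ℤ => (z : ZMod L)) h2
    simp only [Int.cast_natCast, ZMod.natCast_zmod_val, Int.cast_sub, Int.cast_mul, ZMod.natCast_self,
      mul_zero, zero_sub] at h3
    exact h3

/-- A row level set `{b ∈ ℤ/Lℤ : cos(2πb/L) = c}` has at most two elements. [folklore] -/
theorem card_filter_cos_eq_le_two (c : ℝ) :
    (univ.filter fun b : ZMod L => Real.cos (2 * π * (b.val : ℝ) / L) = c).card ≤ 2 := by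
  by_cases hne : (univ.filter fun b : ZMod L => Real.cos (2 * π * (b.val : ℝ) / L) = c).Nonempty
  · obtain ⟨a, ha⟩ := hne
    have hsub : (univ.filter fun b : ZMod L => Real.cos (2 * π * (b.val : ℝ) / L) = c) ⊆ {a, -a} := by
      intro b hb
      rw [mem_filter] at ha hb
      have h := zmod_eq_or_eq_neg_of_cos_eq (L := L) (ha.2.trans hb.2.symm)
      simp only [mem_insert, mem_singleton]
      exact h
    exact (card_le_card hsub).trans Finset.card_le_two
  · rw [not_nonempty_iff_eq_empty.1 hne, card_empty]
    exact Nat.zero_le _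

omit [NeZero L] in
/-- The band in coordinates: `ε_L(k) = -2(cos(2πk₀/L) + cos(2πk₁/L))`. [folklore] -/
theorem torusBand_two_eq (k : TorusSite 2 L) :
    torusBand L k = -2 * (Real.cos (2 * π * ((k 0).val : ℝ) / L) + Real.cos (2 * π * ((k 1).val : ℝ) / L)) := by
  simp only [torusBand, latticeMomentum, Fin.sum_univ_two]

/-- **Level sets of the square-lattice band are thin**: `#{k ∈ (ℤ/Lℤ)² : ε_L(k) = c} ≤ 2L` for every real `c`
(at most two points per row). [folklore] -/
theorem card_levelSet_torusBand_le (c : ℝ) :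
    (univ.filter fun k : TorusSite 2 L => torusBand L k = c).card ≤ 2 * L := by
  set S := univ.filter fun k : TorusSite 2 L => torusBand L k = c with hS
  have hfib : ∀ k₀ : ZMod L, (S.filter fun k => k 0 = k₀).card ≤ 2 := by
    intro k₀
    set c' : ℝ := -c / 2 - Real.cos (2 * π * (k₀.val : ℝ) / L) with hc'
    refine le_trans (Finset.card_le_card_of_injOn (fun k : TorusSite 2 L => k 1)
      (t := univ.filter fun b : ZMod L => Real.cos (2 * π * (b.val : ℝ) / L) = c') ?_ ?_)
      (card_filter_cos_eq_le_two c')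
    · intro k hk
      simp only [coe_filter, Set.mem_setOf_eq, mem_filter, mem_univ, true_and, hS] at hk ⊢
      obtain ⟨hband, hk0⟩ := hk
      have h := torusBand_two_eq k
      rw [hband, hk0] at h
      rw [hc']
      linarith
    · intro k hk k' hk' hkk'
      simp only [coe_filter, Set.mem_setOf_eq, mem_filter, hS] at hk hk'
      funext i
      fin_cases i
      · exact hk.2.trans hk'.2.symm
      · exact hkk'
  calc S.card = ∑ k₀ : ZMod L, (S.filter fun k => k 0 = k₀).card :=
        Finset.card_eq_sum_card_fiberwise (f := fun k : TorusSite 2 L => k 0) (fun _ _ => mem_univ _)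
    _ ≤ ∑ _k₀ : ZMod L, 2 := Finset.sum_le_sum fun k₀ _ => hfib k₀
    _ = 2 * L := by rw [sum_const, card_univ, ZMod.card, smul_eq_mul, mul_comm]

end Summit.HubbardSuperconductivity.CwThesis.Negative

end
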